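import Mathlib.Analysis.SpecialFunctions.Gaussian.GaussianIntegral
import Mathlib.MeasureTheory.Integral.IntegralEqImproper
import Mathlib.Analysis.SpecialFunctions.ExpDeriv
import HarnessLib

/-!
# The single-site φ⁴ Schwinger–Dyson tower `⟨φⁿ V'(φ)⟩ = n ⟨φⁿ⁻¹⟩` — the population identity behind a reference-free exactness column for scalar chains

HONEST FRAMING: exact (Metropolis-corrected) sampling algorithms for lattice gauge theory;
figures of merit are autocorrelation/cost numbers at stated couplings and volumes; no
continuum-physics claim.  (This file belongs to the SCALAR calibration rung S0-A: not a gauge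
result.)

Venture `LatticeQCDFlow` (cell pub-lqcd), sub-topic `Scoring`; FANOUT row 2 (`s0-phi4`: 2-d φ⁴
calibration and the exactness-battery prototype).  NEW WORK of the cell in the sense of the
placement rule (one integration by parts on the real line with an explicit Gaussian domination,
our own proof); the general statement is the lattice Schwinger–Dyson / equation-of-motion
identity `⟨f ∂S/∂φ_x⟩ = ⟨∂f/∂φ_x⟩`, named here, not cited as a tree fact.  Companion of row 11's
`Scoring/SchwingerDysonOnePlaquette.lean` (compact variable, U(1)/SU(2) one plaquette, boundary
term by periodicity); here the variable is NON-COMPACT, so the content is the decay statement: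
the boundary term vanishes because `φⁿ e^{−V(φ)}` and its derivative are integrable on `ℝ`.

## Why the battery cares

The exactness battery of row 2 (BATTERY-REPORT.md v1.1) certifies a φ⁴ sampler by (T1) the
free-field `λ = 0` oracle and (T2) detailed balance on `2 × 2`; at the interacting couplings of
record the only oracle is another implementation (the flow seat's X04).  Row 9's
`latflow.core.schwinger_dyson` (0.2.4 gauge, 0.2.5-dev1 CP(N−1)) gives gauge and CP(N−1) chains
a reference-FREE exactness column `⟨R⟩ = 0`; the scalar rung has none.  The single-site
Schwinger–Dyson identities below are the population values such a column tests for φ⁴: with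
every other site frozen, the conditional law of `φ_x` under `e^{−S}` is `∝ e^{−V(φ_x)}` with the
quartic SITE POTENTIAL `V(φ) = λ φ⁴ + a φ² + b φ + c`, where — in the engine's convention
`S = Σ_x [Σ_μ (φ(x+μ) − φ(x))² + m² φ_x² + λ φ_x⁴]` (latflow.core `phi4_2d`, AKS 2019 / Kanwar
thesis eq. (3.35)) — `a = m² + 2d`, `b = −2 Σ_{±μ} φ(x ± μ)` and `c` collects the other sites.
On every AKS 2019 set `m² = −4` in `d = 2`, so `a = 0`: the conditional law is held together by
the quartic term alone, which is why every statement below asks only `λ > 0` and allows ANY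
real `a, b, c`.

## Content

* `phi4SitePotential`, `phi4SiteForce` (`V' = 4λφ³ + 2aφ + b`), `phi4SiteWeight` (`e^{−V}`),
  their derivatives and continuity;
* `phi4SiteWeight_le_of_coercive`, `integrable_pow_mul_phi4SiteWeight` — a quadratic lower bound
  `ε φ² − K ≤ V(φ)` dominates every moment density `φⁿ e^{−V}` by `e^{K} |φ|ⁿ e^{−εφ²}`
  (Mathlib's `integrable_rpow_mul_exp_neg_mul_sq`);
* **`integral_phi4Site_sd_pow`** — `∫_ℝ (n φⁿ⁻¹ − φⁿ V'(φ)) e^{−V(φ)} dφ = 0` for every `n : ℕ`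
  (Mathlib's `integral_eq_zero_of_hasDerivAt_of_integrable`);
* `phi4SiteZ_pos`, `phi4SiteExpect`, **`phi4Site_sd_pow`** — normalised: `⟨φⁿ V'(φ)⟩ = n ⟨φⁿ⁻¹⟩`;
  `phi4Site_expect_force` (`n = 0`, equation of motion `⟨V'⟩ = 0`) and
  **`phi4Site_expect_phi_mul_force`** (`n = 1`, the virial identity `⟨φ V'(φ)⟩ = 1` — the value
  behind the residual `R_x = φ_x ∂S/∂φ_x − 1`);
* **`phi4SiteMoment_recursion`** — the same tower in moment form,
  `4λ m_{n+3} + 2a m_{n+1} + b m_n = n m_{n−1}`: all moments from `m_0 = 1, m_1, m_2`;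
  `phi4SiteMoment_virial` (`4λ⟨φ⁴⟩ + 2a⟨φ²⟩ + b⟨φ⟩ = 1`);
* the lower bound DISCHARGED: `phi4SitePotential_coercive` (`λ > 0`, any `a b c`:
  `φ² − K ≤ V(φ)`, `K = (a−2)²/(4λ) + b²/4 − c`) and `phi4SitePotential_coercive_gaussian`
  (`λ = 0`, `a > 0`); hence the unconditional corollaries `phi4Site_virial`, `phi4Site_eom`,
  `phi4Site_recursion` (`λ > 0`) and the Gaussian anchor `phi4Site_gaussian_second_moment`
  (`⟨φ²⟩ = 1/(2a)`, the one-site instance of the battery's free-field oracle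
  `G̃(k) = 1/(2(m² + k̂²))`).

Summed over sites (`Σ_x φ_x ∂S/∂φ_x = 2S₂ + 4S₄`, Euler) the virial identity reads
`2⟨S₂⟩ + 4⟨S₄⟩ = |Λ|`: at `λ = 0` the equipartition line `⟨S⟩/V = 1/2` of the engine's free-field
oracle, at `λ > 0` its interacting replacement.

What is NOT here: the lattice statement itself (Fubini over `ℝ^Λ` and the conditional-law
bookkeeping are left to a companion file; this file is the one-variable analysis it rests on),
and any claim about the statistical POWER of an `⟨R⟩ = 0` column against the planted classes
X-1 / X-2 — that is a canary to measure, under the numerics gate.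
-/

namespace Summit.Ventures.LatticeQCDFlow.Scoring

open Real MeasureTheory Set Filter

/-- The single-site quartic potential `V(φ) = λ φ⁴ + a φ² + b φ + c`: the `φ_x`-dependence of a
lattice φ⁴ action with every other site held fixed (kinetic and mass terms give `a φ_x²`, the
neighbours give the linear coefficient `b`, the rest of the lattice the constant `c`). -/
noncomputable def phi4SitePotential (lam a b c φ : ℝ) : ℝ :=
  lam * φ ^ 4 + a * φ ^ 2 + b * φ + c

/-- Its derivative `V'(φ) = 4λ φ³ + 2a φ + b` — the single-site force `∂S/∂φ_x`. -/
noncomputable def phi4SiteForce (lam a b φ : ℝ) : ℝ :=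
  4 * lam * φ ^ 3 + 2 * a * φ + b

/-- The single-site Boltzmann weight `w(φ) = e^{−V(φ)}`. -/
noncomputable def phi4SiteWeight (lam a b c φ : ℝ) : ℝ :=
  Real.exp (-phi4SitePotential lam a b c φ)

/-- `V' ` is the derivative of `V`. -/
theorem hasDerivAt_phi4SitePotential (lam a b c φ : ℝ) :
    HasDerivAt (phi4SitePotential lam a b c) (phi4SiteForce lam a b φ) φ := by
  have h4 : HasDerivAt (fun x : ℝ => lam * x ^ 4) (lam * (4 * φ ^ 3)) φ := by
    simpa using (hasDerivAt_pow 4 φ).const_mul lam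
  have h2 : HasDerivAt (fun x : ℝ => a * x ^ 2) (a * (2 * φ)) φ := by
    simpa using (hasDerivAt_pow 2 φ).const_mul a
  have h1 : HasDerivAt (fun x : ℝ => b * x) (b * 1) φ := (hasDerivAt_id φ).const_mul b
  have h := ((h4.add h2).add h1).add (hasDerivAt_const φ c)
  have heq : phi4SiteForce lam a b φ = lam * (4 * φ ^ 3) + a * (2 * φ) + b * 1 + 0 := by
    unfold phi4SiteForce; ring
  rw [heq]
  exact h

/-- The weight is positive. -/
theorem phi4SiteWeight_pos (lam a b c φ : ℝ) : 0 < phi4SiteWeight lam a b c φ :=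
  Real.exp_pos _

/-- The weight is continuous. -/
theorem continuous_phi4SiteWeight (lam a b c : ℝ) :
    Continuous (phi4SiteWeight lam a b c) := by
  unfold phi4SiteWeight phi4SitePotential
  fun_prop

/-- `w' = −V' · w`. -/
theorem hasDerivAt_phi4SiteWeight (lam a b c φ : ℝ) :
    HasDerivAt (phi4SiteWeight lam a b c)
      (phi4SiteWeight lam a b c φ * -phi4SiteForce lam a b φ) φ := by
  exact (hasDerivAt_phi4SitePotential lam a b c φ).neg.exp

/-- Product rule: `d/dφ [φⁿ w(φ)] = (n φⁿ⁻¹ − φⁿ V'(φ)) w(φ)`. -/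
theorem hasDerivAt_pow_mul_phi4SiteWeight (lam a b c : ℝ) (n : ℕ) (φ : ℝ) :
    HasDerivAt (fun x : ℝ => x ^ n * phi4SiteWeight lam a b c x)
      (((n : ℝ) * φ ^ (n - 1) - φ ^ n * phi4SiteForce lam a b φ)
        * phi4SiteWeight lam a b c φ) φ := by
  have h := (hasDerivAt_pow n φ).mul (hasDerivAt_phi4SiteWeight lam a b c φ)
  have heq : ((n : ℝ) * φ ^ (n - 1) - φ ^ n * phi4SiteForce lam a b φ)
        * phi4SiteWeight lam a b c φ
      = (n : ℝ) * φ ^ (n - 1) * phi4SiteWeight lam a b c φ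
        + φ ^ n * (phi4SiteWeight lam a b c φ * -phi4SiteForce lam a b φ) := by ring
  rw [heq]
  exact h

/-! ## Coercivity and integrability -/

/-- A quadratic lower bound `ε φ² − K ≤ V(φ)` turns the weight into a Gaussian-dominated one:
`w(φ) ≤ e^{K} e^{−ε φ²}`. -/
theorem phi4SiteWeight_le_of_coercive {lam a b c ε K : ℝ}
    (hK : ∀ φ, ε * φ ^ 2 - K ≤ phi4SitePotential lam a b c φ) (φ : ℝ) :
    phi4SiteWeight lam a b c φ ≤ Real.exp K * Real.exp (-ε * φ ^ 2) := by
  rw [phi4SiteWeight, ← Real.exp_add]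
  have h := hK φ
  exact Real.exp_le_exp.mpr (by linarith)

/-- `φ ↦ φⁿ e^{−ε φ²}` is integrable on `ℝ` for `ε > 0` (Mathlib's
`integrable_rpow_mul_exp_neg_mul_sq` at a natural exponent). -/
theorem integrable_pow_mul_gaussian {ε : ℝ} (hε : 0 < ε) (n : ℕ) :
    Integrable (fun φ : ℝ => φ ^ n * Real.exp (-ε * φ ^ 2)) := by
  have h := integrable_rpow_mul_exp_neg_mul_sq hε (s := (n : ℝ))
    (by have : (0 : ℝ) ≤ n := n.cast_nonneg; linarith)
  refine h.congr (Eventually.of_forall fun φ => ?_)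
  simp only [Real.rpow_natCast]

/-- Under a quadratic lower bound on `V`, every moment density `φⁿ e^{−V(φ)}` is integrable
on `ℝ`. -/
theorem integrable_pow_mul_phi4SiteWeight {lam a b c ε K : ℝ} (hε : 0 < ε)
    (hK : ∀ φ, ε * φ ^ 2 - K ≤ phi4SitePotential lam a b c φ) (n : ℕ) :
    Integrable (fun φ : ℝ => φ ^ n * phi4SiteWeight lam a b c φ) := by
  refine Integrable.mono' (((integrable_pow_mul_gaussian hε n).norm).const_mul (Real.exp K)) ?_ ?_
  · exact ((continuous_pow n).mul (continuous_phi4SiteWeight lam a b c)).aestronglyMeasurable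
  · refine Eventually.of_forall fun φ => ?_
    rw [norm_mul, norm_mul, Real.norm_eq_abs, Real.norm_eq_abs, Real.norm_eq_abs,
      abs_of_pos (phi4SiteWeight_pos lam a b c φ), abs_of_pos (Real.exp_pos _)]
    have hw := phi4SiteWeight_le_of_coercive hK φ
    have habs : 0 ≤ |φ ^ n| := abs_nonneg _
    calc |φ ^ n| * phi4SiteWeight lam a b c φ
        ≤ |φ ^ n| * (Real.exp K * Real.exp (-ε * φ ^ 2)) := mul_le_mul_of_nonneg_left hw habs
      _ = Real.exp K * (|φ ^ n| * Real.exp (-ε * φ ^ 2)) := by ring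

/-! ## The Schwinger–Dyson tower (unnormalised and normalised) -/

/-- **Single-site Schwinger–Dyson identity, unnormalised.**  Under a quadratic lower bound on
`V`, for every `n : ℕ`: `∫_ℝ (n φⁿ⁻¹ − φⁿ V'(φ)) e^{−V(φ)} dφ = 0` (the integrand is the derivative
of the integrable function `φⁿ e^{−V(φ)}`, whose derivative is integrable too). -/
theorem integral_phi4Site_sd_pow {lam a b c ε K : ℝ} (hε : 0 < ε)
    (hK : ∀ φ, ε * φ ^ 2 - K ≤ phi4SitePotential lam a b c φ) (n : ℕ) :
    ∫ φ : ℝ, ((n : ℝ) * φ ^ (n - 1) - φ ^ n * phi4SiteForce lam a b φ)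
        * phi4SiteWeight lam a b c φ = 0 := by
  refine integral_eq_zero_of_hasDerivAt_of_integrable
    (hasDerivAt_pow_mul_phi4SiteWeight lam a b c n) ?_
    (integrable_pow_mul_phi4SiteWeight hε hK n)
  have hI := fun k => integrable_pow_mul_phi4SiteWeight hε hK k
  have h1 : Integrable (fun φ : ℝ => (n : ℝ) * (φ ^ (n - 1) * phi4SiteWeight lam a b c φ)) :=
    (hI (n - 1)).const_mul _
  have h2 : Integrable (fun φ : ℝ => 4 * lam * (φ ^ (n + 3) * phi4SiteWeight lam a b c φ)) :=
    (hI (n + 3)).const_mul _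
  have h3 : Integrable (fun φ : ℝ => 2 * a * (φ ^ (n + 1) * phi4SiteWeight lam a b c φ)) :=
    (hI (n + 1)).const_mul _
  have h4 : Integrable (fun φ : ℝ => b * (φ ^ n * phi4SiteWeight lam a b c φ)) :=
    (hI n).const_mul _
  refine (h1.sub ((h2.add h3).add h4)).congr (Eventually.of_forall fun φ => ?_)
  simp only [Pi.sub_apply, Pi.add_apply, phi4SiteForce]
  ring

/-- The single-site partition function `Z = ∫_ℝ e^{−V(φ)} dφ`. -/
noncomputable def phi4SiteZ (lam a b c : ℝ) : ℝ :=
  ∫ φ : ℝ, phi4SiteWeight lam a b c φ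

/-- `Z > 0`. -/
theorem phi4SiteZ_pos {lam a b c ε K : ℝ} (hε : 0 < ε)
    (hK : ∀ φ, ε * φ ^ 2 - K ≤ phi4SitePotential lam a b c φ) :
    0 < phi4SiteZ lam a b c := by
  have hI : Integrable (fun φ : ℝ => phi4SiteWeight lam a b c φ) := by
    simpa using integrable_pow_mul_phi4SiteWeight hε hK 0
  unfold phi4SiteZ
  unfold phi4SiteWeight at hI ⊢
  exact integral_exp_pos hI

/-- Expectation under the single-site law: `⟨f⟩ = (1/Z) ∫_ℝ f(φ) e^{−V(φ)} dφ`. -/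
noncomputable def phi4SiteExpect (lam a b c : ℝ) (f : ℝ → ℝ) : ℝ :=
  (∫ φ : ℝ, f φ * phi4SiteWeight lam a b c φ) / phi4SiteZ lam a b c

/-- `⟨1⟩ = 1`. -/
theorem phi4SiteExpect_one {lam a b c ε K : ℝ} (hε : 0 < ε)
    (hK : ∀ φ, ε * φ ^ 2 - K ≤ phi4SitePotential lam a b c φ) :
    phi4SiteExpect lam a b c (fun _ => 1) = 1 := by
  have hZ := phi4SiteZ_pos hε hK
  unfold phi4SiteExpect
  simp only [one_mul]
  exact div_self hZ.ne'

/-- **Single-site Schwinger–Dyson tower, normalised.**  Under a quadratic lower bound on `V`,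
for every `n : ℕ`: `⟨φⁿ V'(φ)⟩ = n ⟨φⁿ⁻¹⟩`. -/
theorem phi4Site_sd_pow {lam a b c ε K : ℝ} (hε : 0 < ε)
    (hK : ∀ φ, ε * φ ^ 2 - K ≤ phi4SitePotential lam a b c φ) (n : ℕ) :
    phi4SiteExpect lam a b c (fun φ => φ ^ n * phi4SiteForce lam a b φ)
      = n * phi4SiteExpect lam a b c (fun φ => φ ^ (n - 1)) := by
  have hI := fun k => integrable_pow_mul_phi4SiteWeight hε hK k
  unfold phi4SiteExpect
  rw [← mul_div_assoc]
  congr 1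
  have h0 := integral_phi4Site_sd_pow hε hK n
  have hA : Integrable (fun φ : ℝ => (n : ℝ) * (φ ^ (n - 1) * phi4SiteWeight lam a b c φ)) :=
    (hI (n - 1)).const_mul _
  have h2 : Integrable (fun φ : ℝ => 4 * lam * (φ ^ (n + 3) * phi4SiteWeight lam a b c φ)) :=
    (hI (n + 3)).const_mul _
  have h3 : Integrable (fun φ : ℝ => 2 * a * (φ ^ (n + 1) * phi4SiteWeight lam a b c φ)) :=
    (hI (n + 1)).const_mul _
  have h4 : Integrable (fun φ : ℝ => b * (φ ^ n * phi4SiteWeight lam a b c φ)) :=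
    (hI n).const_mul _
  have hB : Integrable (fun φ : ℝ => φ ^ n * phi4SiteForce lam a b φ
      * phi4SiteWeight lam a b c φ) := by
    refine ((h2.add h3).add h4).congr (Eventually.of_forall fun φ => ?_)
    simp only [Pi.add_apply, phi4SiteForce]
    ring
  have hsplit : ∫ φ : ℝ, ((n : ℝ) * φ ^ (n - 1) - φ ^ n * phi4SiteForce lam a b φ)
      * phi4SiteWeight lam a b c φ
      = (∫ φ : ℝ, (n : ℝ) * (φ ^ (n - 1) * phi4SiteWeight lam a b c φ))
        - ∫ φ : ℝ, φ ^ n * phi4SiteForce lam a b φ * phi4SiteWeight lam a b c φ := by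
    rw [← integral_sub hA hB]
    congr 1
    ext φ
    ring
  rw [hsplit, sub_eq_zero, integral_const_mul] at h0
  exact h0.symm

/-- `n = 0`: the equation of motion `⟨V'(φ)⟩ = 0`, i.e. `4λ⟨φ³⟩ + 2a⟨φ⟩ + b = 0`. -/
theorem phi4Site_expect_force {lam a b c ε K : ℝ} (hε : 0 < ε)
    (hK : ∀ φ, ε * φ ^ 2 - K ≤ phi4SitePotential lam a b c φ) :
    phi4SiteExpect lam a b c (phi4SiteForce lam a b) = 0 := by
  have h := phi4Site_sd_pow hε hK 0
  simpa using h

/-- `n = 1`: **the virial identity `⟨φ V'(φ)⟩ = 1`** — the population value behind a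
reference-free exactness column `R = φ_x ∂S/∂φ_x − 1`, `⟨R⟩ = 0`. -/
theorem phi4Site_expect_phi_mul_force {lam a b c ε K : ℝ} (hε : 0 < ε)
    (hK : ∀ φ, ε * φ ^ 2 - K ≤ phi4SitePotential lam a b c φ) :
    phi4SiteExpect lam a b c (fun φ => φ * phi4SiteForce lam a b φ) = 1 := by
  have h := phi4Site_sd_pow hε hK 1
  simp only [pow_one, Nat.cast_one, one_mul, Nat.sub_self, pow_zero] at h
  rw [h]
  exact phi4SiteExpect_one hε hK

/-- The `n`-th moment `m_n = ⟨φⁿ⟩` of the single-site law. -/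
noncomputable def phi4SiteMoment (lam a b c : ℝ) (n : ℕ) : ℝ :=
  phi4SiteExpect lam a b c (fun φ => φ ^ n)

/-- `m_0 = 1`. -/
theorem phi4SiteMoment_zero {lam a b c ε K : ℝ} (hε : 0 < ε)
    (hK : ∀ φ, ε * φ ^ 2 - K ≤ phi4SitePotential lam a b c φ) :
    phi4SiteMoment lam a b c 0 = 1 := by
  unfold phi4SiteMoment
  simpa using phi4SiteExpect_one hε hK

/-- **The Schwinger–Dyson tower in moment form (the loop-equation recursion).**  Under a
quadratic lower bound on `V`, for every `n : ℕ`: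
`4λ m_{n+3} + 2a m_{n+1} + b m_n = n m_{n−1}` — every moment of the single-site law is
determined by `m_1, m_2` (and `m_0 = 1`) through this recursion; a sampler of the WRONG density
violates it at some `n`. -/
theorem phi4SiteMoment_recursion {lam a b c ε K : ℝ} (hε : 0 < ε)
    (hK : ∀ φ, ε * φ ^ 2 - K ≤ phi4SitePotential lam a b c φ) (n : ℕ) :
    4 * lam * phi4SiteMoment lam a b c (n + 3) + 2 * a * phi4SiteMoment lam a b c (n + 1)
        + b * phi4SiteMoment lam a b c n
      = n * phi4SiteMoment lam a b c (n - 1) := by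
  have hI := fun k => integrable_pow_mul_phi4SiteWeight hε hK k
  have h2 : Integrable (fun φ : ℝ => 4 * lam * (φ ^ (n + 3) * phi4SiteWeight lam a b c φ)) :=
    (hI (n + 3)).const_mul _
  have h3 : Integrable (fun φ : ℝ => 2 * a * (φ ^ (n + 1) * phi4SiteWeight lam a b c φ)) :=
    (hI (n + 1)).const_mul _
  have h4 : Integrable (fun φ : ℝ => b * (φ ^ n * phi4SiteWeight lam a b c φ)) :=
    (hI n).const_mul _
  have h23 : Integrable (fun φ : ℝ => 4 * lam * (φ ^ (n + 3) * phi4SiteWeight lam a b c φ)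
      + 2 * a * (φ ^ (n + 1) * phi4SiteWeight lam a b c φ)) := h2.add h3
  have hnum : (∫ φ : ℝ, φ ^ n * phi4SiteForce lam a b φ * phi4SiteWeight lam a b c φ)
      = 4 * lam * (∫ φ : ℝ, φ ^ (n + 3) * phi4SiteWeight lam a b c φ)
        + 2 * a * (∫ φ : ℝ, φ ^ (n + 1) * phi4SiteWeight lam a b c φ)
        + b * (∫ φ : ℝ, φ ^ n * phi4SiteWeight lam a b c φ) := by
    have step : (∫ φ : ℝ, φ ^ n * phi4SiteForce lam a b φ * phi4SiteWeight lam a b c φ)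
        = ∫ φ : ℝ, (4 * lam * (φ ^ (n + 3) * phi4SiteWeight lam a b c φ)
            + 2 * a * (φ ^ (n + 1) * phi4SiteWeight lam a b c φ))
            + b * (φ ^ n * phi4SiteWeight lam a b c φ) := by
      congr 1
      ext φ
      simp only [phi4SiteForce]
      ring
    rw [step, integral_add h23 h4, integral_add h2 h3, integral_const_mul, integral_const_mul,
      integral_const_mul]
  have h := phi4Site_sd_pow hε hK n
  simp only [phi4SiteMoment, phi4SiteExpect] at h ⊢
  rw [hnum] at h
  rw [← h]
  ring

/-- The virial identity in moment form: `4λ ⟨φ⁴⟩ + 2a ⟨φ²⟩ + b ⟨φ⟩ = 1`. -/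
theorem phi4SiteMoment_virial {lam a b c ε K : ℝ} (hε : 0 < ε)
    (hK : ∀ φ, ε * φ ^ 2 - K ≤ phi4SitePotential lam a b c φ) :
    4 * lam * phi4SiteMoment lam a b c 4 + 2 * a * phi4SiteMoment lam a b c 2
        + b * phi4SiteMoment lam a b c 1 = 1 := by
  have h := phi4SiteMoment_recursion hε hK 1
  have h0 := phi4SiteMoment_zero hε hK
  simp only [Nat.cast_one, one_mul, show (1 : ℕ) + 3 = 4 from rfl, show (1 : ℕ) + 1 = 2 from rfl,
    show (1 : ℕ) - 1 = 0 from rfl, h0] at h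
  exact h

/-! ## Discharging the lower bound: `λ > 0` (any `a, b, c`) and the Gaussian case -/

/-- **Coercivity for `λ > 0`**, every real `a, b, c` — in particular the tachyonic AKS 2019 sets
(`m² = −4` in two dimensions, so the conditional quadratic coefficient `a = m² + 2d` vanishes):
`φ² − K ≤ V(φ)` with `K = (a − 2)²/(4λ) + b²/4 − c`
(since `V(φ) − φ² + K = λ (φ² + (a − 2)/(2λ))² + (φ + b/2)² ≥ 0`). -/
theorem phi4SitePotential_coercive {lam : ℝ} (hlam : 0 < lam) (a b c φ : ℝ) :
    1 * φ ^ 2 - ((a - 2) ^ 2 / (4 * lam) + b ^ 2 / 4 - c) ≤ phi4SitePotential lam a b c φ := by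
  unfold phi4SitePotential
  have hlam' : lam ≠ 0 := hlam.ne'
  have h1 : 0 ≤ lam * (φ ^ 2 + (a - 2) / (2 * lam)) ^ 2 := by positivity
  have h2 : 0 ≤ (φ + b / 2) ^ 2 := sq_nonneg _
  have e1 : lam * (φ ^ 2 + (a - 2) / (2 * lam)) ^ 2
      = lam * φ ^ 4 + (a - 2) * φ ^ 2 + (a - 2) ^ 2 / (4 * lam) := by
    field_simp
    ring
  have e2 : (φ + b / 2) ^ 2 = φ ^ 2 + b * φ + b ^ 2 / 4 := by ring
  rw [e1] at h1
  rw [e2] at h2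
  linarith

/-- **Coercivity in the Gaussian case** `λ = 0`, `a > 0`: `(a/2) φ² − K ≤ V(φ)` with
`K = b²/(2a) − c` (since `V(φ) − (a/2)φ² + K = (a/2)(φ + b/a)² ≥ 0`). -/
theorem phi4SitePotential_coercive_gaussian {a : ℝ} (ha : 0 < a) (b c φ : ℝ) :
    a / 2 * φ ^ 2 - (b ^ 2 / (2 * a) - c) ≤ phi4SitePotential 0 a b c φ := by
  unfold phi4SitePotential
  have ha' : a ≠ 0 := ha.ne'
  have h : 0 ≤ a / 2 * (φ + b / a) ^ 2 := by positivity
  have e : a / 2 * (φ + b / a) ^ 2 = a / 2 * φ ^ 2 + b * φ + b ^ 2 / (2 * a) := by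
    field_simp
    ring
  rw [e] at h
  linarith

/-- **The φ⁴ single-site virial identity, unconditional for `λ > 0`:** `⟨φ V'(φ)⟩ = 1` for every
real `a, b, c`. -/
theorem phi4Site_virial {lam : ℝ} (hlam : 0 < lam) (a b c : ℝ) :
    phi4SiteExpect lam a b c (fun φ => φ * phi4SiteForce lam a b φ) = 1 :=
  phi4Site_expect_phi_mul_force one_pos (phi4SitePotential_coercive hlam a b c)

/-- **The φ⁴ single-site equation of motion, unconditional for `λ > 0`:** `⟨V'(φ)⟩ = 0`. -/
theorem phi4Site_eom {lam : ℝ} (hlam : 0 < lam) (a b c : ℝ) :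
    phi4SiteExpect lam a b c (phi4SiteForce lam a b) = 0 :=
  phi4Site_expect_force one_pos (phi4SitePotential_coercive hlam a b c)

/-- **The φ⁴ single-site moment recursion, unconditional for `λ > 0`:**
`4λ m_{n+3} + 2a m_{n+1} + b m_n = n m_{n−1}` for every `n`. -/
theorem phi4Site_recursion {lam : ℝ} (hlam : 0 < lam) (a b c : ℝ) (n : ℕ) :
    4 * lam * phi4SiteMoment lam a b c (n + 3) + 2 * a * phi4SiteMoment lam a b c (n + 1)
        + b * phi4SiteMoment lam a b c n
      = n * phi4SiteMoment lam a b c (n - 1) :=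
  phi4SiteMoment_recursion one_pos (phi4SitePotential_coercive hlam a b c) n

/-- **Gaussian anchor** (`λ = 0`, `b = 0`, `a > 0`): `⟨φ²⟩ = 1/(2a)` — the one-site instance of
the free-field oracle `G̃(k) = 1/(2(m² + k̂²))` of the exactness battery's leg T1, recovered here
from the same Schwinger–Dyson identity (`2a ⟨φ²⟩ = 1`). -/
theorem phi4Site_gaussian_second_moment {a : ℝ} (ha : 0 < a) (c : ℝ) :
    phi4SiteMoment 0 a 0 c 2 = 1 / (2 * a) := by
  have h := phi4SiteMoment_virial (half_pos ha) (phi4SitePotential_coercive_gaussian ha 0 c)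
  simp only [mul_zero, zero_mul, zero_add, add_zero] at h
  rw [eq_div_iff (by positivity)]
  linarith

end Summit.Ventures.LatticeQCDFlow.Scoring
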